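import Literature.MathematicalPhysics.QuantumFieldTheory.BalabanImbrieJaffe1984to88.BIJ88ActInLastCubeSupp309
import Literature.MathematicalPhysics.QuantumFieldTheory.BalabanImbrieJaffe1984to88.BIJ88DexpCondMeanCov305
import Literature.MathematicalPhysics.QuantumFieldTheory.BalabanImbrieJaffe1984to88.BIJ88ExpectTilt305

/-!
# `BalabanImbrieJaffe1984to88.BIJ88ActInFarCube309` — T. Bałaban, J. Imbrie, A. Jaffe, *Effective action and cluster properties of the abelian
Higgs model*, Commun. Math. Phys. **114** (1988) 257–315 [BalabanImbrieJaffe1988], Sect. 5.14 (5.14.3)–(5.14.4) p. 309 [PDF 53] with Sect. 5.13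
p. 305–307 [PDF 49–51] and [Balaban1982Higgs2] (2.28)–(2.29) p. 563: **THE LOCATED ACTIVITY OF A POLYMER WITH A FAR CUBE IS BOUNDED BY THE
CONDITIONAL-MEAN FLUCTUATION OF THAT CUBE'S PULLED-DOWN FACTOR** — the smoothness-free order-one chain of the re-scoped flip item of row
C2.Eq5.14.3-5.14.4 (r16 ROWS-C2-part2 v2.253) assembled: if the (5.14.3) derivative observables `Π_{□_i⊂X″} fD_i` of the polymer `X″` depend only on
the fields off a set of sites `Λ`, and `□_n ⊆ Λ`, `n ∈ X″`, is a cube that `Δ` does not couple to `Λᶜ` (a FAR cube), then for `|X″| ≥ 2`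

  `|g₃-activity(H, X″)| ≤ 2^{|X″|−1} · 2K₀ · M`,

`K₀` bounding `|Π fD_i − c₀|` (any constant `c₀`: `0` on decorated polymers, `1` on vacuum polymers) and `M` bounding, uniformly over the
parameters `s ∈ [0,1]^I` supported in `X″`, the conditional-mean fluctuation `⟨|D_n∘cm − D_n(cm₀)|⟩_s` of the pulled-down factor of the cube `n`
given the fields off `Λ` (p. 307: *"Each time some □_i's are joined, we have s-derivatives, which produce functional derivatives, chains of covariances
C_ω(α) … If the walk ω(α) wanders through more than a few cubes, we begin to pickup factors e^{−cr(e_k)}"* — here WITHOUT functional derivatives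
on the observable: the chain of covariances is print's (2.29) boundary operator acting on the conditional mean).  Composition of p36 g19
`BIJ88ActInLastCubeSupp309.abs_actIn_le_of_dexp_bound_supp` (one `s`-derivative), `dexp_singleton_sub_const` (constants drop out) and
`BIJ88DexpCondMeanCov305.abs_dexp_singleton_le_condMean` (conditioning); `M` is made explicit by `BIJ88DexpCondMeanMajorant305.expect_abs_Dfun_cm_sub_le`
— where the decay letter (i) enters.

statement-level skeleton of published theorems with citation tags; proofs where landed; nothing here is a claim about the Yang–Mills mass gap

PDF held: `paper:balaban1988-cmp114-bij-abelian-higgs-effective-action` (journal page = PDF page + 256); p. 307 (p0051) and p. 309 (p0053 L14–16: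
*"The proof of this estimate is similar to the one for g₂. We mention only the new features."*) as quoted.

WHAT IS PROVED (unit `lit-balaban-p36`, generation 19 of the Phase-2 proof seat p36; SKELETON rows C2.Eq5.14.3-5.14.4 / C2.Eq5.13.3-5.13.4 of
`HOME/lit-balaban-r16/ROWS-C2-part2.md`, owner r16; 0 definitions, 0 `Prop` facts, theorems only).
* `interpForm_far` (the cornered precision inherits the far-cube support condition), `abs_dexp_prod_le_of_fluct` (the `∂{n}` bound for an
  observable of the fields off `Λ`, any constant subtracted), **`abs_actIn_le_of_condMean_fluct`** (the display).
HONEST SCOPE: an abstract bound at the level of the §5.13 model's located activity; `K₀`, the locality of `Π fD_i` off `Λ` and the fluctuation bound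
`M` are hypotheses (the slot-level instance — V-decorated end cube of a three-cube chain, slot-free middle and far cubes, clause (ii) for `K₀`,
letter (i) for `M` — is the next file).  Imports `BIJ88ActInLastCubeSupp309`, `BIJ88DexpCondMeanCov305` (p36 g19); modifies nothing.  NOT summit
progress; NOT continuum; NOT Clay.  Cell `lit-balaban` Phase 2, seat p36 gen 19 (owner r16, referee ref-5).
-/

noncomputable section

open Finset MeasureTheory Matrix Function Filter
open Literature.MathematicalPhysics.QuantumFieldTheory.Balaban1983to89
open Literature.MathematicalPhysics.QuantumFieldTheory.BalabanImbrieJaffe1984to88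
open B2Eq228Conditioning (In Out resIn resOut glue blkIn blkMix condShift weight source)
open BIJ88Sect5Statements (CutoffProfile)
open BIJ88DirichletForms305 (interpForm interpForm_apply interpForm_posDef)
open BIJ88DirichletDeriv305 (blockPair)
open BIJ88PolymerRep5134 (corner)
open BIJ88Expansion5143Gauss (fD)
open BIJ88SlotMomentsGauss308 (uD)
open BIJ88Eq5145CornerModel (slotB slotY)
open BIJ88Eq5145CornerUrsell (cubeIn)
open BIJ88W6PrimeVsupp (actIn)
open BIJ88SecondOrder5133 (num Dfun integrable_growth hasDerivAt_integral_interp_growth)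
open BIJ88CumulantAllOrders5133 (dexp)
open BIJ88ExpectTilt305 (num_one_pos)
open BIJ88DexpCondMeanCov305 (abs_dexp_singleton_le_condMean)
open BIJ88ActInLastCubeSupp309 (dexp_singleton_sub_const abs_actIn_le_of_dexp_bound_supp)

namespace Literature.MathematicalPhysics.QuantumFieldTheory.BalabanImbrieJaffe1984to88.BIJ88ActInFarCube309

variable {α I : Type} [Fintype α] [DecidableEq α] [Fintype I] [DecidableEq I] (blk : α → I) (Δ : Matrix α α ℝ) (ℱ : α → ℝ)

/-! ## §1 The `∂{n}` bound for an observable of the fields off `Λ` -/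

/-- the interpolated precision couples the sites of `□_n ⊆ Λ` only where `Δ` does. [cite: BalabanImbrieJaffe1988, §5.13 p.305] -/
theorem interpForm_far (s : I → ℝ) (P : α → Prop) {n : I} (hPn : ∀ x, blk x = n → P x) (hfar : ∀ x y, blk x = n → ¬ P y → Δ x y = 0)
    (x y : α) (hx : blk x = n) (hy : ¬ P y) : interpForm blk Δ s x y = 0 := by
  rw [interpForm_apply]
  have hne : blk x ≠ blk y := fun h => hy (hPn y (h.symm.trans hx))
  rw [if_neg hne, hfar x y hx hy, mul_zero]

section Dexp

variable {Δ} (hΔ : Δ.PosDef) {c C : ℝ} (hc : 0 < c) (hcΔ : ∀ v, c * (v ⬝ᵥ v) ≤ v ⬝ᵥ (Δ *ᵥ v)) (hCΔ : ∀ v, v ⬝ᵥ (Δ *ᵥ v) ≤ C * (v ⬝ᵥ v))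
  {s : I → ℝ} (hs : ∀ l, 0 ≤ s l ∧ s l ≤ 1) (P : α → Prop) [DecidablePred P] {n : I} (hPn : ∀ x, blk x = n → P x)
  (hfar : ∀ x y, blk x = n → ¬ P y → Δ x y = 0)
  {H : (α → ℝ) → ℝ} (hHm : Measurable H) (c₀ : ℝ) {K₀ : ℝ} (hK : ∀ φ, |H φ - c₀| ≤ K₀)
  (hloc : ∀ φ ψ : α → ℝ, (∀ x, ¬ P x → φ x = ψ x) → H φ = H ψ)

include hΔ hc hcΔ hCΔ hs hPn hfar hHm hK hloc in
/-- **`|∂{n}⟨H⟩(s)| ≤ 2K₀ · ⟨|D_n∘cm − a|⟩_s`** for an observable `H` of the fields OFF `Λ = {x | P x}` with `|H − c₀| ≤ K₀`, `□_n ⊆ Λ` not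
coupled to `Λᶜ`, any `a` (`∂{n}⟨H⟩ = ∂{n}⟨H − c₀⟩` by `dexp_singleton_sub_const`, then `abs_dexp_singleton_le_condMean` for `H − c₀`).
[cite: BalabanImbrieJaffe1988, §5.13 p.307] -/
theorem abs_dexp_prod_le_of_fluct (a : ℝ) :
    |dexp blk Δ ℱ H {n} s| ≤ 2 * K₀ *
      (num blk Δ ℱ (fun φ => |Dfun blk Δ s n (glue P (condShift P (interpForm blk Δ s) ℱ (resOut P φ)) (resOut P φ)) - a|) s
        / num blk Δ ℱ (fun _ => 1) s) := by
  have hK0 : 0 ≤ K₀ := (abs_nonneg _).trans (hK 0)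
  have hHb : ∀ φ, ‖H φ‖ ≤ K₀ + |c₀| := fun φ => by
    rw [Real.norm_eq_abs]
    calc |H φ| = |(H φ - c₀) + c₀| := by rw [sub_add_cancel]
      _ ≤ |H φ - c₀| + |c₀| := abs_add_le _ _
      _ ≤ K₀ + |c₀| := add_le_add (hK φ) le_rfl
  -- `∂{n}⟨H⟩ = ∂{n}⟨H − c₀⟩`
  have hZ : num blk Δ ℱ (fun _ => (1 : ℝ)) s ≠ 0 := (num_one_pos blk hΔ hs ℱ).ne'
  have hε : 2 * (0 : ℝ) < c := by linarith
  have hgrow : ∀ φ : α → ℝ, ‖H φ‖ ≤ (K₀ + |c₀|) * Real.exp (0 * (φ ⬝ᵥ φ)) := fun φ => by rw [zero_mul, Real.exp_zero, mul_one]; exact hHb φ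
  have hgrow1 : ∀ φ : α → ℝ, ‖(1 : ℝ)‖ ≤ 1 * Real.exp (0 * (φ ⬝ᵥ φ)) := fun φ => by simp
  have hDH := (hasDerivAt_integral_interp_growth blk hΔ hcΔ hCΔ hs n (hs n) ℱ hHm.aestronglyMeasurable hε hgrow).1
  have hD1 := (hasDerivAt_integral_interp_growth blk hΔ hcΔ hCΔ hs n (hs n) ℱ (G := fun _ => (1 : ℝ)) aestronglyMeasurable_const hε hgrow1).1
  simp only [update_eq_self, mul_one] at hDH hD1
  have hH := integrable_growth blk hcΔ hs ℱ hHm.aestronglyMeasurable hε hgrow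
  rw [← dexp_singleton_sub_const blk Δ ℱ H c₀ n s hZ hDH hD1 hH]
  -- conditioning for `H − c₀`
  have hK' : ∀ φ, ‖H φ - c₀‖ ≤ K₀ := fun φ => by rw [Real.norm_eq_abs]; exact hK φ
  have hloc' : ∀ φ ψ : α → ℝ, (∀ x, ¬ P x → φ x = ψ x) → H φ - c₀ = H ψ - c₀ := fun φ ψ h => by rw [hloc φ ψ h]
  exact abs_dexp_singleton_le_condMean blk hΔ hc hcΔ ℱ hs P hPn hfar (hHm.sub_const c₀) hK' hloc' a

end Dexp

/-! ## §2 The located activity of a polymer with a far cube -/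

section Activity

variable (adj : I → I → Prop) [DecidableRel adj]
variable (χ : CutoffProfile) {ι υ : Type*} [DecidableEq ι] [DecidableEq υ]
variable (p ek : ℝ) (B : Finset ι) (Φ : ι → (α → ℝ) → ℝ) (c : ι → ℝ) (Ys : Finset υ) (V : υ → (α → ℝ) → ℝ)
variable (cube : ↥B ⊕ ↥Ys → I)

/-- **THE LOCATED ACTIVITY OF A POLYMER WITH A FAR CUBE**: `|g₃(H, X″)| ≤ 2^{|X″|−1}·2K₀·M` when the derivative observables `Π_{□_i⊂X″} fD_i`
depend only on the fields OFF the site set `Λ = {x | P x}`, `|Π fD_i − c₀| ≤ K₀`, `□_n ⊆ Λ` (`n ∈ X″`) is not coupled to `Λᶜ` by `Δ`, and `M`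
bounds the conditional-mean fluctuation `⟨|D_n∘cm − D_n(cm₀)|⟩_s` of the pulled-down factor of `□_n` given the fields off `Λ`, for the cornered
precision `Δ_{1_{Λ′}}` and every `s ∈ [0,1]^I` supported in `X″`. [cite: BalabanImbrieJaffe1988, (5.14.3)–(5.14.4) p.309; p.307 (Sect. 5.13)] -/
theorem abs_actIn_le_of_condMean_fluct (Λ X : Finset I) (t : ℝ) {L : Type*} [DecidableEq L]
    (γ : L → ↥(slotB B Ys cube X) ⊕ ↥(slotY B Ys cube X)) (H : Finset L) {X'' : Finset I} (h2 : 2 ≤ X''.card)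
    (hΔ : (interpForm blk Δ (corner ℝ Λ)).PosDef) {cl Cu : ℝ} (hcl : 0 < cl)
    (hclΔ : ∀ v, cl * (v ⬝ᵥ v) ≤ v ⬝ᵥ (interpForm blk Δ (corner ℝ Λ) *ᵥ v))
    (hCuΔ : ∀ v, v ⬝ᵥ (interpForm blk Δ (corner ℝ Λ) *ᵥ v) ≤ Cu * (v ⬝ᵥ v))
    (hf : ∀ i (φ ψ : α → ℝ), (∀ x, blk x = i → φ x = ψ x) →
      fD (uD χ p ek (slotB B Ys cube X) (fun b : ↥B => Φ b) (fun b : ↥B => c b) (slotY B Ys cube X) (fun Y : ↥Ys => V Y) t)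
        (cubeIn cube X) γ H i φ =
      fD (uD χ p ek (slotB B Ys cube X) (fun b : ↥B => Φ b) (fun b : ↥B => c b) (slotY B Ys cube X) (fun Y : ↥Ys => V Y) t)
        (cubeIn cube X) γ H i ψ)
    (hfm : Measurable (fun ψ : α → ℝ => ∏ i ∈ X'',
      fD (uD χ p ek (slotB B Ys cube X) (fun b : ↥B => Φ b) (fun b : ↥B => c b) (slotY B Ys cube X) (fun Y : ↥Ys => V Y) t)
        (cubeIn cube X) γ H i ψ))
    (c₀ : ℝ) {K₀ : ℝ} (hK : ∀ ψ : α → ℝ, |(∏ i ∈ X'',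
      fD (uD χ p ek (slotB B Ys cube X) (fun b : ↥B => Φ b) (fun b : ↥B => c b) (slotY B Ys cube X) (fun Y : ↥Ys => V Y) t)
        (cubeIn cube X) γ H i ψ) - c₀| ≤ K₀)
    (P : α → Prop) [DecidablePred P] (hloc : ∀ φ ψ : α → ℝ, (∀ x, ¬ P x → φ x = ψ x) →
      (∏ i ∈ X'', fD (uD χ p ek (slotB B Ys cube X) (fun b : ↥B => Φ b) (fun b : ↥B => c b) (slotY B Ys cube X) (fun Y : ↥Ys => V Y) t)
        (cubeIn cube X) γ H i φ) =
      (∏ i ∈ X'', fD (uD χ p ek (slotB B Ys cube X) (fun b : ↥B => Φ b) (fun b : ↥B => c b) (slotY B Ys cube X) (fun Y : ↥Ys => V Y) t)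
        (cubeIn cube X) γ H i ψ))
    {n : I} (hn : n ∈ X'') (hPn : ∀ x, blk x = n → P x) (hfar : ∀ x y, blk x = n → ¬ P y → Δ x y = 0) {M : ℝ}
    (hM : ∀ s : I → ℝ, (∀ l, 0 ≤ s l ∧ s l ≤ 1) → (∀ l, l ∉ X'' → s l = 0) →
      num blk (interpForm blk Δ (corner ℝ Λ)) ℱ (fun φ => |Dfun blk (interpForm blk Δ (corner ℝ Λ)) s n
          (glue P (condShift P (interpForm blk (interpForm blk Δ (corner ℝ Λ)) s) ℱ (resOut P φ)) (resOut P φ))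
        - Dfun blk (interpForm blk Δ (corner ℝ Λ)) s n
          (glue P ((blkIn P (interpForm blk (interpForm blk Δ (corner ℝ Λ)) s))⁻¹ *ᵥ resIn P ℱ) 0)|) s
        / num blk (interpForm blk Δ (corner ℝ Λ)) ℱ (fun _ => 1) s ≤ M) :
    |actIn blk Δ ℱ adj χ p ek B Φ c Ys V cube Λ X t γ H X''| ≤ 2 ^ (X''.card - 1) * (2 * K₀ * M) := by
  have hK0 : 0 ≤ K₀ := (abs_nonneg _).trans (hK 0)
  have hKn : ∀ ψ : α → ℝ, ‖∏ i ∈ X'',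
      fD (uD χ p ek (slotB B Ys cube X) (fun b : ↥B => Φ b) (fun b : ↥B => c b) (slotY B Ys cube X) (fun Y : ↥Ys => V Y) t)
        (cubeIn cube X) γ H i ψ‖ ≤ K₀ + |c₀| := fun ψ => by
    rw [Real.norm_eq_abs]
    have h := hK ψ
    have := abs_add_le (∏ i ∈ X'', fD (uD χ p ek (slotB B Ys cube X) (fun b : ↥B => Φ b) (fun b : ↥B => c b) (slotY B Ys cube X)
      (fun Y : ↥Ys => V Y) t) (cubeIn cube X) γ H i ψ - c₀) c₀
    rw [sub_add_cancel] at this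
    linarith
  have hfar' : ∀ x y, blk x = n → ¬ P y → interpForm blk Δ (corner ℝ Λ) x y = 0 :=
    interpForm_far blk Δ (corner ℝ Λ) P hPn hfar
  refine abs_actIn_le_of_dexp_bound_supp blk Δ ℱ adj χ p ek B Φ c Ys V cube Λ X t γ H h2 hΔ hcl hclΔ hCuΔ hf hfm.aestronglyMeasurable
    hKn hn fun s hs' hs0 => ?_
  have h := abs_dexp_prod_le_of_fluct blk ℱ hΔ hcl hclΔ hCuΔ hs' P hPn hfar' hfm c₀ hK hloc
    (Dfun blk (interpForm blk Δ (corner ℝ Λ)) s n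
      (glue P ((blkIn P (interpForm blk (interpForm blk Δ (corner ℝ Λ)) s))⁻¹ *ᵥ resIn P ℱ) 0))
  exact h.trans (mul_le_mul_of_nonneg_left (hM s hs' hs0) (by positivity))

end Activity

end Literature.MathematicalPhysics.QuantumFieldTheory.BalabanImbrieJaffe1984to88.BIJ88ActInFarCube309

end
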